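import Literature.AlgebraicGeometry.HodgeTheory.WeilClassesSixfolds
import Literature.AlgebraicGeometry.HodgeTheory.WeilClassesFourfoldsStep2
import HarnessLib

/-!
# Weil classes on split (= hyperbolic) abelian sixfolds, Markman 2025 Thm. 1.5.1: proved reductions

Family `hodge`, layer `Literature/AlgebraicGeometry/HodgeTheory`. Sibling proof file of the story
`WeilClassesSixfoldsSplit` / `WeilClassesSixfolds`. The named fact is
`Markman2025_weilClasses_algebraic_hyperbolicSixfold` (file `WeilClassesSixfolds`; E. Markman,
arXiv:2502.03415, **Theorem 1.5.1**, held and read — v2 PDF p. 9, lines 7–13 (the held corpus chunk is p0007;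
"p. 7" is not a PDF page: v2 p. 7 carries §1.4 / Thm. 1.4.1) — verbatim: "Let `d` be a positive
integer. Set `K := ℚ(√-d)`. The Hodge-Weil classes of polarized abelian sixfolds of Weil type with
complex multiplication by `K` and with discriminant `-1` are algebraic."); its second spelling
`Markman2025_weilClasses_algebraic_abelianSixfold_split` was merged into it (file
`WeilClassesSixfoldsSplit`, `…_split_iff`, `Iff.rfl`) so that the tree carries ONE named fact for
the theorem. That fact is NOT discharged here and this file introduces NO new named fact (D-0026):
it records, as PROVED theorems about the surviving name,

1. the sharper upper bound "the Hodge conjecture for complex abelian SIXFOLDS ⇒ the fact";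
2. the LAST inference of the printed proof of Thm. 1.5.1 (arXiv:2502.03415 v2, end of §9.3, "Proof of Theorem
   1.5.1", PDF p. 88, verbatim): "The algebraicity of the Hodge-Weil classes follows from
   that of `κ₃(E)` and Theorem 1.4.1 (3) [the `η(K)`-translates of `κ₃` and `h³` span `ℚh³ ⊕ HW`],
   since given a polarized abelian variety of Weil type `(A, η, h)` the rational endomorphisms
   `η(K) ⊂ End_ℚ(A)` act on `H^*(A, ℚ)` via algebraic correspondences." — on the carriers this is
   `mem_algebraicClasses_of_mem_span_pullbacks` (pure submodule algebra: a class in the span of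
   algebraic classes and of their pull-backs along endomorphisms preserving algebraicity is
   algebraic) and the reduction `…_of_translates_span`, whose hypotheses are exactly the printed
   inputs: (κ + span) on every hyperbolic `(A, φ, h)` a set `T` of ALGEBRAIC classes in `H⁶` (print:
   `κ₃` of the deformed secant sheaf — algebraic by the semiregularity theorem for twisted sheaves,
   §7.4, Chern classes of coherent sheaves being algebraic — and `h³`) such that every rational
   `(3,3)` Weil class lies in the `ℂ`-span of `T` and its `(x·𝟙 + y·φ)^*`-translates (Thm. 1.4.1 (3),
   carried along the deformation of §9.3), and (corr) the pull-backs `(x·𝟙 + y·φ)^*` preserve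
   `algebraicClasses A.X 3` (isogenies act by algebraic correspondences; on the support rendering
   `N³H⁶` this is the flat pull-back `map_mem_algebraicClasses_of_flat` once `x·𝟙 + y·φ ≠ 0` is known
   to be finite flat — not available for these endomorphisms on the carriers, hence a hypothesis);
3. the same last step in the K-THEORETIC form used by the fourfold sibling
   (`WeilClassesFourfoldsProofs.…_of_span_chernCharacter_le`): Voisin I Thm. 11.32 (`⊆`) in degree
   `6` on abelian sixfolds + "every rational `(3,3)` Weil class of a hyperbolic sixfold is, for some
   Hodge model, in the `ℂ`-span of third Chern characters of holomorphic bundles" ⇒ the fact (and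
   the converse bookkeeping from `⊇`);
4. **Cor. 1.6.1 (proof) / arXiv:2509.23403 §11.5 Step 2, assembled with the fact as its sixfold
   input**: `….fourfold_of_hyperbolic_partner` — granted the fact, the Weil classes of a complex
   abelian FOURFOLD `(A₁, φ₁)` are algebraic as soon as it has a surface partner `(A₂, φ₂)` and a
   compatible `Φ` on `A₁ × A₂` (`Φ ≫ Φ = -d`) making the product sixfold HYPERBOLIC for some
   symmetrised hyperplane class, together with Schoen's inputs (V), (H), (P), (G) of
   `WeilClassesFourfoldsStep2.…pointwise_of_sixfold_partner` (which took the sixfold statement as an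
   anonymous hypothesis `hB`; here `hB` is the fact instantiated at `A₁.prod A₂`,
   `….prod_of_hyperbolic`). Verbatim (arXiv:2502.03415v2, proof of Cor. 1.6.1, PDF p. 9; "p. 7" = held corpus chunk): "Theorem 1.5.1
   implies that the Hodge-Weil classes are algebraic for every abelian fourfold of Weil-type, for all
   imaginary quadratic number fields, and for all discriminants, by degenerating abelian sixfolds of
   Weil type of discriminant `-1` to products of abelian fourfolds of Weil type of arbitrary
   discriminant and abelian surfaces of Weil type [schoen]."

## Why the fact itself is not proved here (triage, for the record)

The printed proof of Thm. 1.5.1 (§§2–9 of arXiv:2502.03415) needs, before its last inference: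
Orlov's derived equivalence `Dᵇ(X × X) ≃ Dᵇ(X × X̂)` and its cohomological `Spin(V)`-equivariance
(§§5–6), the Chevalley isomorphism `S ⊗ S ≅ ⋀^*V` and pure spinors (§2, §6), Hochschild cohomology
and the obstruction map `ob_F : HH²(X) → Ext²(F, F)` of the secant sheaves on a genus-`3` Jacobian
(§8.3, §9), the Buchweitz–Flenner semiregularity theorem and its twisted version on abelian varieties
(§7), the period domain of polarized abelian `2n`-folds of Weil type as an adjoint orbit in
`Spin(V_ℝ)_P` (§4) and the countability of the Hodge loci (Voisin); and the reduction of an arbitrary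
discriminant-`-1` sixfold to that deformation component (Landherr / van Geemen 5.3: `(n, K, det H)`
determines the component up to isogeny; isogeny invariance, cf. `WeilClassesIsogenyDescent`). None of
these has a carrier in the tree (no `Pic⁰`/dual abelian variety, no derived categories of coherent
sheaves, no Atiyah class — `SemiregularityMap` is a hypothesis structure —, no `H^*(A(ℂ)) = ⋀^*H¹`, no
moduli of Weil type on real carriers). See the seat's NOTES.md `## Census`.

## References

* [Markman2025SecantWeil] E. Markman, Cycles on abelian 2n-folds of Weil type from secant sheaves on
  abelian n-folds, arXiv:2502.03415: Thm. 1.4.1 (3), §1.5, Thm. 1.5.1, Cor. 1.6.1 and its proof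
  (v2 PDF p. 9), "Proof of Theorem 1.5.1" at the end of §9.3 (v2 PDF p. 88) — read against the arXiv v2
  PDF/TeX (the held corpus chunks of this paper expand the author's hidden `\hide{}` drafts and number
  them: their §§10–14 and "p. 74" are not public locators).
* [Markman2025SurveySecant] E. Markman, Secant sheaves and Weil classes on abelian varieties,
  arXiv:2509.23403: Thm. 1.2, §11.5 Steps 1–2.
* [Schoen1998HodgeWeilAddendum] C. Schoen, Compositio Math. 114 (1998), §10.
* [VoisinHodgeI2002] C. Voisin, Hodge Theory and Complex Algebraic Geometry I, Thm. 11.32.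
* [Deligne2000] P. Deligne, The Hodge conjecture (Clay), §1, §2 Remark (ii).
* [vanGeemen1994HodgeAV] B. van Geemen, LNM 1594 (1994), Lemma 5.2, 5.3–5.4.
-/

noncomputable section

open CategoryTheory

namespace Literature.AlgebraicGeometry.HodgeTheory

open Literature.AlgebraicTopology.SingularHomology

section HodgeTheory

/-! ### 1. Upper bound: the Hodge conjecture for abelian sixfolds -/

/-- **The Hodge conjecture for complex abelian sixfolds ⇒ the fact** (sharper than
`…_of_hodgeConjectureFor` of file `WeilClassesSixfolds`, which assumes the conjecture for all smooth
projective varieties): a rational `(3,3)`-class of the Weil plane of a hyperbolic sixfold is in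
particular a rational `(3,3)`-class on a smooth projective sixfold. Nothing beyond the summit
statement restricted to abelian sixfolds is claimed by the fact. [cite: Deligne2000, §1] -/
theorem Markman2025_weilClasses_algebraic_hyperbolicSixfold_of_hodgeConjectureFor_abelianSixfold
    (h : ∀ A : Motives.AbelianVariety ℂ, A.dim = 2 * 3 → Motives.IsSmoothProjective (2 * 3) A.X →
      HodgeConjectureFor (2 * 3) A.X) :
    Markman2025_weilClasses_algebraic_hyperbolicSixfold :=
  fun _ _ A _ hA hX _ _ _ _ _ _ c hc h33 _ ↦ (h A hA hX).2 3 c hc h33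

/-! ### 2. The last inference of the printed proof: translates of algebraic classes -/

/-- **Submodule algebra behind "`η(K)` acts via algebraic correspondences".** On a complex abelian
variety `A`, let `T ⊆ H²ᵖ(A(ℂ); ℂ)` consist of algebraic classes and let `Ψ` be a set of
endomorphisms of `A` whose pull-backs preserve `algebraicClasses A.X p`. Then every class in the
`ℂ`-span of `T` and of the translates `ψ^* t` (`ψ ∈ Ψ`, `t ∈ T`) is algebraic — the shape of
Markman's last inference "the algebraicity of the Hodge–Weil classes follows from that of `κ₃(E)`
and [the `η(K)`-translates of `κ₃` and `h³` span `ℚh³ ⊕ HW`], since … `η(K)` act on `H^*(A, ℚ)` via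
algebraic correspondences". [cite: Markman2025SecantWeil, Proof of Thm. 1.5.1 (end of §9.3, v2 PDF p. 88)] -/
theorem mem_algebraicClasses_of_mem_span_pullbacks {A : Motives.AbelianVariety ℂ} {p : ℕ}
    {T : Set (complexBetti A.X (2 * p))} (hT : T ⊆ algebraicClasses A.X p) {Ψ : Set (A ⟶ A)}
    (hΨ : ∀ ψ ∈ Ψ, ∀ z ∈ algebraicClasses A.X p,
      complexBetti.map ψ.hom.hom.hom (2 * p) z ∈ algebraicClasses A.X p)
    {c : complexBetti A.X (2 * p)}
    (hc : c ∈ Submodule.span ℂ (T ∪ ⋃ ψ ∈ Ψ, complexBetti.map ψ.hom.hom.hom (2 * p) '' T)) :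
    c ∈ algebraicClasses A.X p := by
  refine (Submodule.span_le.2 ?_) hc
  rintro w (hw | hw)
  · exact hT hw
  · simp only [Set.mem_iUnion, Set.mem_image] at hw
    obtain ⟨ψ, hψ, t, ht, rfl⟩ := hw
    exact hΨ ψ hψ t (hT ht)

/-- **Markman's last inference, as a proved reduction of the fact.** Suppose that for every `d ≥ 1`
and every hyperbolic `(A, φ, h)` as in the fact (corr) the pull-backs along the test endomorphisms
`x·𝟙 + y·φ` (`x y : ℕ`; these generate the action of the order `ℕ[φ] ⊆ K = ℚ(φ)` used by
`weilClassesOf`) preserve `algebraicClasses A.X 3` ("`η(K)` act via algebraic correspondences"),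
and (κ + span) there is a set `T ⊆ H⁶(A(ℂ); ℂ)` of ALGEBRAIC classes (print: `κ₃` of the deformed
semiregular secant sheaf — algebraic as a Chern class of a coherent twisted sheaf — and `h³`) such
that every rational `(3,3)`-class of the Weil plane lies in the `ℂ`-span of `T` and its translates
`(x·𝟙 + y·φ)^* t` (Thm. 1.4.1 (3): "`η(K)`-translates of `κ₃` and `h³` span `ℚh³ ⊕ HW`", transported
along the deformation of §9.3). THEN the fact. The two hypotheses are the residual obligations of the
printed proof on these carriers; they are hypotheses of a theorem, not named facts (D-0026).
[cite: Markman2025SecantWeil, Thm. 1.4.1 (3) and Proof of Thm. 1.5.1 (end of §9.3, v2 PDF p. 88)] -/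
theorem Markman2025_weilClasses_algebraic_hyperbolicSixfold_of_translates_span
    (hcorr : ∀ (d : ℕ), 0 < d → ∀ (A : Motives.AbelianVariety ℂ) (φ : A ⟶ A), A.dim = 2 * 3 →
      Motives.IsSmoothProjective (2 * 3) A.X → φ ≫ φ = -(d • 𝟙 A) →
        ∀ (x y : ℕ), ∀ z ∈ algebraicClasses A.X 3,
          complexBetti.map (x • 𝟙 A + y • φ).hom.hom.hom (2 * 3) z ∈ algebraicClasses A.X 3)
    (hκ : ∀ (d : ℕ), 0 < d → ∀ (A : Motives.AbelianVariety ℂ) (φ : A ⟶ A), A.dim = 2 * 3 →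
      Motives.IsSmoothProjective (2 * 3) A.X → φ ≫ φ = -(d • 𝟙 A) →
        ∀ (e : Motives.ProjectiveEmbedding A.X) (a : complexBetti (Motives.projectiveSpace e.n ℂ) 2),
          IsRationalClass a → a ≠ 0 →
            Motives.IsHyperbolicWeilType A φ 3
              ((d : ℂ) • complexBetti.map e.ι 2 a +
                complexBetti.map φ.hom.hom.hom 2 (complexBetti.map e.ι 2 a)) →
              ∃ T : Set (complexBetti A.X (2 * 3)), T ⊆ algebraicClasses A.X 3 ∧
                ∀ c : complexBetti A.X (2 * 3), IsRationalClass c →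
                  IsOfHodgeType (2 * 3) A.X (2 * 3) 3 3 c → c ∈ weilClassesOf A φ 3 d →
                    c ∈ Submodule.span ℂ (T ∪ ⋃ ψ ∈ {ψ : A ⟶ A | ∃ x y : ℕ, ψ = x • 𝟙 A + y • φ},
                      complexBetti.map ψ.hom.hom.hom (2 * 3) '' T)) :
    Markman2025_weilClasses_algebraic_hyperbolicSixfold := by
  intro d hd A φ hA hX hφ e a ha ha0 hhyp c hc h33 hW
  obtain ⟨T, hT, hspan⟩ := hκ d hd A φ hA hX hφ e a ha ha0 hhyp
  refine mem_algebraicClasses_of_mem_span_pullbacks hT ?_ (hspan c hc h33 hW)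
  rintro ψ ⟨x, y, rfl⟩ z hz
  exact hcorr d hd A φ hA hX hφ x y z hz

/-! ### 3. The last step in K-theoretic form (Voisin I Thm. 11.32) -/

/-- **K-theoretic form of Markman's theorem + Voisin I Thm. 11.32 (`⊆`) ⇒ the fact** (the sixfold
twin of `WeilClassesFourfoldsProofs.…_of_span_chernCharacter_le`). If (a) on every complex abelian
sixfold and every Hodge model `M` the `ℂ`-span of the third Chern characters of holomorphic vector
bundles is contained in `algebraicClasses A.X 3` ("the Chern classes of `E` are also classes of
algebraic cycles", Voisin I p. 283; Deligne §2 (ii)), and (b) every rational `(3,3)`-class of the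
Weil plane of a HYPERBOLIC `(A, φ, h)` lies, for some Hodge model, in that span — the form in which
arXiv:2502.03415 delivers algebraicity (the Weil classes are combinations of `h³` and of translates
of the characteristic class `κ₃` of deformed reflexive twisted sheaves, §9.3) — then the fact.
[cite: Markman2025SecantWeil, Thm. 1.4.1 (3), Thm. 1.5.1 and §9.3]
[cite: VoisinHodgeI2002, Thm. 11.32] [cite: Deligne2000, §2 Remark (ii)] -/
theorem Markman2025_weilClasses_algebraic_hyperbolicSixfold_of_span_chernCharacter_le
    (hle : ∀ A : Motives.AbelianVariety ℂ, A.dim = 2 * 3 → Motives.IsSmoothProjective (2 * 3) A.X →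
      ∀ M : HodgeModel (2 * 3) A.X,
        Submodule.span ℂ (M.holomorphicBundleChernCharacter 3) ≤ algebraicClasses A.X 3)
    (hK : ∀ (d : ℕ), 0 < d → ∀ (A : Motives.AbelianVariety ℂ) (φ : A ⟶ A), A.dim = 2 * 3 →
      Motives.IsSmoothProjective (2 * 3) A.X → φ ≫ φ = -(d • 𝟙 A) →
        ∀ (e : Motives.ProjectiveEmbedding A.X) (a : complexBetti (Motives.projectiveSpace e.n ℂ) 2),
          IsRationalClass a → a ≠ 0 →
            Motives.IsHyperbolicWeilType A φ 3
              ((d : ℂ) • complexBetti.map e.ι 2 a +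
                complexBetti.map φ.hom.hom.hom 2 (complexBetti.map e.ι 2 a)) →
              ∀ c : complexBetti A.X (2 * 3), IsRationalClass c →
                IsOfHodgeType (2 * 3) A.X (2 * 3) 3 3 c → c ∈ weilClassesOf A φ 3 d →
                  ∃ M : HodgeModel (2 * 3) A.X,
                    c ∈ Submodule.span ℂ (M.holomorphicBundleChernCharacter 3)) :
    Markman2025_weilClasses_algebraic_hyperbolicSixfold := by
  intro d hd A φ hA hX hφ e a ha ha0 hhyp c hc h33 hW
  obtain ⟨M, hcM⟩ := hK d hd A φ hA hX hφ e a ha ha0 hhyp c hc h33 hW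
  exact hle A hA hX M hcM

/-- **The same with (a) supplied by the tree's named fact** `span_holomorphicBundleChernCharacter_eq_algebraicClasses`
(Voisin I Thm. 11.32 ⊗ ℂ; only `⊆` in degree `6` on abelian sixfolds is used): granted that fact,
the named fact is EXACTLY the K-theoretic form (b) of Markman's Thm. 1.5.1.
[cite: VoisinHodgeI2002, Thm. 11.32] [cite: Markman2025SecantWeil, Thm. 1.5.1 and §9.3] -/
theorem Markman2025_weilClasses_algebraic_hyperbolicSixfold_of_span_chernCharacter_eq
    (hX : span_holomorphicBundleChernCharacter_eq_algebraicClasses)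
    (hK : ∀ (d : ℕ), 0 < d → ∀ (A : Motives.AbelianVariety ℂ) (φ : A ⟶ A), A.dim = 2 * 3 →
      Motives.IsSmoothProjective (2 * 3) A.X → φ ≫ φ = -(d • 𝟙 A) →
        ∀ (e : Motives.ProjectiveEmbedding A.X) (a : complexBetti (Motives.projectiveSpace e.n ℂ) 2),
          IsRationalClass a → a ≠ 0 →
            Motives.IsHyperbolicWeilType A φ 3
              ((d : ℂ) • complexBetti.map e.ι 2 a +
                complexBetti.map φ.hom.hom.hom 2 (complexBetti.map e.ι 2 a)) →
              ∀ c : complexBetti A.X (2 * 3), IsRationalClass c →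
                IsOfHodgeType (2 * 3) A.X (2 * 3) 3 3 c → c ∈ weilClassesOf A φ 3 d →
                  ∃ M : HodgeModel (2 * 3) A.X,
                    c ∈ Submodule.span ℂ (M.holomorphicBundleChernCharacter 3)) :
    Markman2025_weilClasses_algebraic_hyperbolicSixfold :=
  Markman2025_weilClasses_algebraic_hyperbolicSixfold_of_span_chernCharacter_le
    (fun _ _ hA M ↦ (hX hA M 3).le) hK

/-- **Converse bookkeeping**: the K-theoretic form (b) follows from the fact and the inclusion `⊇`
of Thm. 11.32 — so, granted the equality of spans, (b) and the named fact are equivalent renderings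
of Thm. 1.5.1 and nothing stronger than the fact is hidden in (b).
[cite: VoisinHodgeI2002, Thm. 11.32] [cite: Deligne2000, §2 Remark (ii)] -/
theorem Markman2025_weilClasses_algebraic_hyperbolicSixfold.span_chernCharacter
    (h : Markman2025_weilClasses_algebraic_hyperbolicSixfold)
    (hge : ∀ A : Motives.AbelianVariety ℂ, A.dim = 2 * 3 → Motives.IsSmoothProjective (2 * 3) A.X →
      ∀ M : HodgeModel (2 * 3) A.X,
        algebraicClasses A.X 3 ≤ Submodule.span ℂ (M.holomorphicBundleChernCharacter 3)) :
    ∀ (d : ℕ), 0 < d → ∀ (A : Motives.AbelianVariety ℂ) (φ : A ⟶ A), A.dim = 2 * 3 →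
      Motives.IsSmoothProjective (2 * 3) A.X → φ ≫ φ = -(d • 𝟙 A) →
        ∀ (e : Motives.ProjectiveEmbedding A.X) (a : complexBetti (Motives.projectiveSpace e.n ℂ) 2),
          IsRationalClass a → a ≠ 0 →
            Motives.IsHyperbolicWeilType A φ 3
              ((d : ℂ) • complexBetti.map e.ι 2 a +
                complexBetti.map φ.hom.hom.hom 2 (complexBetti.map e.ι 2 a)) →
              ∀ c : complexBetti A.X (2 * 3), IsRationalClass c →
                IsOfHodgeType (2 * 3) A.X (2 * 3) 3 3 c → c ∈ weilClassesOf A φ 3 d →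
                  ∃ M : HodgeModel (2 * 3) A.X,
                    c ∈ Submodule.span ℂ (M.holomorphicBundleChernCharacter 3) := by
  intro d hd A φ hA hX hφ e a ha ha0 hhyp c hc h33 hW
  have hc' : c ∈ algebraicClasses A.X 3 := h d hd A φ hA hX hφ e a ha ha0 hhyp c hc h33 hW
  obtain ⟨M, -⟩ := h33
  exact ⟨M, hge A hA hX M hc'⟩

/-! ### 4. Cor. 1.6.1 (proof) assembled: the fact is the sixfold input of §11.5 Step 2 -/

variable (G : GysinFormalism) {A₁ A₂ : Motives.AbelianVariety ℂ}

/-- **The fact delivers the sixfold input `hB` of `…pointwise_of_sixfold_partner` for a HYPERBOLIC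
product sixfold.** For a fourfold `A₁` and a surface `A₂` (so `A₁ × A₂` is a smooth projective
sixfold, `dim_prod_eq_two_mul`, `isSmoothProjective_prod_two_mul`), an endomorphism `Φ` of
`A₁ × A₂` with `Φ ≫ Φ = -d` (e.g. `φ₁ × φ₂`, `prodLift_comp_self_eq_neg_nsmul`), a projective
embedding `e` of the product and a rational `a ≠ 0` making `(A₁ × A₂, Φ)` hyperbolic for the
symmetrised hyperplane class ("the discriminant of their product polarized abelian sixfold of Weil
type … is the coset of `-1`. The sixfold is hence of split type and so its Weil classes are
algebraic", arXiv:2509.23403 §11.5 Step 2): every rational `(3,3)`-class of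
`weilClassesOf (A₁ × A₂) Φ 3 d` is algebraic. [cite: Markman2025SurveySecant, §11.5 Step 2]
[cite: Markman2025SecantWeil, Thm. 1.5.1 and Cor. 1.6.1 (proof)] -/
theorem Markman2025_weilClasses_algebraic_hyperbolicSixfold.prod_of_hyperbolic
    (h : Markman2025_weilClasses_algebraic_hyperbolicSixfold) {d : ℕ} (hd : 0 < d)
    {Φ : A₁.prod A₂ ⟶ A₁.prod A₂} (hA₁d : A₁.dim = 2 * 2) (hA₂d : A₂.dim = 2 * 1)
    (hA₁ : Motives.IsSmoothProjective (2 * 2) A₁.X) (hA₂ : Motives.IsSmoothProjective (2 * 1) A₂.X)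
    (hΦ : Φ ≫ Φ = -(d • 𝟙 (A₁.prod A₂))) (e : Motives.ProjectiveEmbedding (A₁.prod A₂).X)
    {a : complexBetti (Motives.projectiveSpace e.n ℂ) 2} (ha : IsRationalClass a) (ha0 : a ≠ 0)
    (hhyp : Motives.IsHyperbolicWeilType (A₁.prod A₂) Φ 3
      ((d : ℂ) • complexBetti.map e.ι 2 a +
        complexBetti.map Φ.hom.hom.hom 2 (complexBetti.map e.ι 2 a))) :
    ∀ c : complexBetti (A₁.prod A₂).X (2 * 3), IsRationalClass c →
      IsOfHodgeType (2 * 3) (A₁.prod A₂).X (2 * 3) 3 3 c → c ∈ weilClassesOf (A₁.prod A₂) Φ 3 d →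
        c ∈ algebraicClasses (A₁.prod A₂).X 3 :=
  have hdim : (A₁.prod A₂).dim = 2 * 3 := by
    have h6 := dim_prod_eq_two_mul hA₁d hA₂d
    omega
  h d hd (A₁.prod A₂) Φ hdim (isSmoothProjective_prod_two_mul hA₁ hA₂) hΦ e a ha ha0 hhyp

/-- **Cor. 1.6.1 (proof) = §11.5 Step 2, with Thm. 1.5.1 in the shape of the fact as its sixfold
input (assembled).** Granted the fact: let `(A₁, φ₁)` be a complex abelian fourfold with an
endomorphism, `d ≥ 1`, `(A₂, φ₂)` an abelian surface with an endomorphism, `Φ` an endomorphism of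
`A₁ × A₂` over both (`Φ ≫ prᵢ = prᵢ ≫ φᵢ`) with `Φ ≫ Φ = -d`, such that `(A₁ × A₂, Φ)` is HYPERBOLIC
for the symmetrised hyperplane class of some projective embedding `e` and rational `a ≠ 0` ("there
exists a polarized abelian surface of Weil type `(A₂,η₂,h₂)`, such that the discriminant of their
product … is the coset of `-1`"); assume Schoen's inputs of `…pointwise_of_sixfold_partner`: (V) cup
products of algebraic classes of codimensions `3` and `1` on the sixfold are algebraic, (H) `pr₁^*`,
`pr₂^*`, `∪` respect Hodge types on the sixfold, (P) a rational `(1,1)` Weil class `w = u₊ + u₋` of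
`(A₂, φ₂)`, an algebraic `η ∈ H²(A₂(ℂ))` and the two non-zero transfer scalars
`pr_{1*}pr₂^*(u± ∪ η)`, (G) a Gysin formalism. THEN every rational `(2,2)`-class of the Weil plane
of `(A₁, φ₁)` is algebraic — "It follows that the Weil classes of `(A₁,η₁,h₁)` are algebraic, by
[schoen]." Not here: the EXISTENCE of such a partner (Schoen / Deligne–Milne: choose `(A₂, η₂, h₂)`
with the complementary discriminant; no Riemann form on `H₁(A(ℂ), ℚ)` in the tree).
[cite: Markman2025SecantWeil, Cor. 1.6.1 (proof)] [cite: Markman2025SurveySecant, §11.5 Step 2]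
[cite: Schoen1998HodgeWeilAddendum, §10 (Proposition and proof, pp. 332–333)] -/
theorem Markman2025_weilClasses_algebraic_hyperbolicSixfold.fourfold_of_hyperbolic_partner
    (h : Markman2025_weilClasses_algebraic_hyperbolicSixfold) {d : ℕ} (hd : 0 < d)
    {φ₁ : A₁ ⟶ A₁} {φ₂ : A₂ ⟶ A₂} {Φ : A₁.prod A₂ ⟶ A₁.prod A₂}
    (hA₁d : A₁.dim = 2 * 2) (hA₂d : A₂.dim = 2 * 1)
    (hA₁ : Motives.IsSmoothProjective (2 * 2) A₁.X) (hA₂ : Motives.IsSmoothProjective (2 * 1) A₂.X)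
    (h₁ : Φ ≫ Motives.AbelianVariety.fst A₁ A₂ = Motives.AbelianVariety.fst A₁ A₂ ≫ φ₁)
    (h₂ : Φ ≫ Motives.AbelianVariety.snd A₁ A₂ = Motives.AbelianVariety.snd A₁ A₂ ≫ φ₂)
    (hΦ : Φ ≫ Φ = -(d • 𝟙 (A₁.prod A₂))) (e : Motives.ProjectiveEmbedding (A₁.prod A₂).X)
    {a : complexBetti (Motives.projectiveSpace e.n ℂ) 2} (ha : IsRationalClass a) (ha0 : a ≠ 0)
    (hhyp : Motives.IsHyperbolicWeilType (A₁.prod A₂) Φ 3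
      ((d : ℂ) • complexBetti.map e.ι 2 a +
        complexBetti.map Φ.hom.hom.hom 2 (complexBetti.map e.ι 2 a)))
    (hcup : ∀ ⦃x : complexBetti (A₁.prod A₂).X (2 * 3)⦄ ⦃b : complexBetti (A₁.prod A₂).X (2 * 1)⦄,
      x ∈ algebraicClasses (A₁.prod A₂).X 3 → b ∈ algebraicClasses (A₁.prod A₂).X 1 →
        cupProduct (show 2 * 3 + 2 * 1 = 2 * (2 + 2 * 1) by rfl) x b ∈
          algebraicClasses (A₁.prod A₂).X (2 + 2 * 1))
    (hfst : PreservesHodgeType (2 * 3) (2 * 2) (Motives.AbelianVariety.fst A₁ A₂).hom.hom.hom)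
    (hsnd : PreservesHodgeType (2 * 3) (2 * 1) (Motives.AbelianVariety.snd A₁ A₂).hom.hom.hom)
    (hcupH : CupPreservesHodgeType (2 * 3) (A₁.prod A₂).X)
    {up um η : complexBetti A₂.X (2 * 1)} (hup : up ∈ weilClassesPlus A₂ φ₂ 1 d)
    (hum : um ∈ weilClassesMinus A₂ φ₂ 1 d) (hr₂ : IsRationalClass (up + um))
    (hw₂ : IsOfHodgeType (2 * 1) A₂.X (2 * 1) 1 1 (up + um)) (hη : η ∈ algebraicClasses A₂.X 1)
    (hnep : G.gysin (isSmoothProjective_prod hA₁ hA₂) hA₁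
        (Motives.AbelianVariety.fst A₁ A₂).hom.hom.hom
        (show 2 * (2 * 1) + 2 * (2 * 2) = 0 + 2 * (2 * 2 + 2 * 1) by omega)
        (complexBetti.map (Motives.AbelianVariety.snd A₁ A₂).hom.hom.hom (2 * (2 * 1))
          (cupProduct (show 2 * 1 + 2 * 1 = 2 * (2 * 1) by omega) up η)) ≠ 0)
    (hnem : G.gysin (isSmoothProjective_prod hA₁ hA₂) hA₁
        (Motives.AbelianVariety.fst A₁ A₂).hom.hom.hom
        (show 2 * (2 * 1) + 2 * (2 * 2) = 0 + 2 * (2 * 2 + 2 * 1) by omega)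
        (complexBetti.map (Motives.AbelianVariety.snd A₁ A₂).hom.hom.hom (2 * (2 * 1))
          (cupProduct (show 2 * 1 + 2 * 1 = 2 * (2 * 1) by omega) um η)) ≠ 0) :
    ∀ c : complexBetti A₁.X (2 * 2), IsRationalClass c →
      IsOfHodgeType (2 * 2) A₁.X (2 * 2) 2 2 c → c ∈ weilClassesOf A₁ φ₁ 2 d →
        c ∈ algebraicClasses A₁.X 2 :=
  Markman2025_weilClasses_algebraic_abelianFourfold.pointwise_of_sixfold_partner G hd hA₁ hA₂ h₁ h₂
    (Markman2025_weilClasses_algebraic_hyperbolicSixfold.prod_of_hyperbolic h hd hA₁d hA₂d hA₁ hA₂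
      hΦ e ha ha0 hhyp)
    hcup hfst hsnd hcupH hup hum hr₂ hw₂ hη hnep hnem

end HodgeTheory

end Literature.AlgebraicGeometry.HodgeTheory

end
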